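import Mathlib.LinearAlgebra.Trace
import Mathlib.Analysis.SpecialFunctions.Pow.Real
import Literature.NumberTheory.EllipticCurves.Newforms
import Literature.NumberTheory.QuadraticFields.BinaryQuadraticFormsClassNumber
import HarnessLib

/-!
# The Eichler–Selberg trace formula for `T_n` on `S_k(Γ₀(N), χ)` (holomorphic GL₂ trace formula
# with a Hecke operator, level `N`, nebentypus `χ`): geometric side and the identity as a named fact

Source: R. Schoof, M. van der Vlugt, *Hecke operators and the weight distributions of certain
codes*, J. Combin. Theory Ser. A **57** (1991), **Thm. 2.2**, p. 168 (the formula of H. Cohen,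
*Trace des opérateurs de Hecke sur `Γ₀(N)`*, Sém. Th. Nombres Bordeaux 1976–77, exp. 4, proved in
J. Oesterlé's thesis, Orsay 1977; first explicit version Hijikata 1974; adelic proof for `k ≥ 3`,
`(n, N) = 1` in Knightly–Li, *Traces of Hecke operators*, AMS Surveys 133, 2006). Held copy of the
source: `paper:doi-10-1016-0097-3165-91-90016-a` (Elsevier open archive), pp. 165–170 read.

## The printed statement (SchoofVandervlugt1991, Thm. 2.2)

Let `N ≥ 1`, `χ : (ℤ/Nℤ)ˣ → ℂˣ` a character of conductor `N_χ` (extended by `χ(m) = 0` for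
`gcd(m, N) > 1`), `k ≥ 2` an integer with `χ(-1) = (-1)^k`. For every `n ≥ 1` the trace of the
Hecke operator `T_n` (given on `q`-expansions by `a_m(T_n f) = Σ_{d ∣ (m,n)} χ(d) d^{k-1} a_{mn/d²}(f)`,
loc. cit. (2)) on the space `S_k(Γ₀(N), χ) = {f ∈ S_k(Γ₁(N)) : f|_k σ = χ(d) f, σ = (a b; c d) ∈ Γ₀(N)}`
is `Tr(T_n) = A₁ + A₂ + A₃ + A₄`, where

* `A₁ = n^{k/2-1} χ(√n) (k-1)/12 · ψ(N)`, with `χ(√n) = 0` if `n` is not a square and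
  `ψ(N) = N ∏_{p ∣ N} (1 + 1/p)`;
* `A₂ = -½ Σ_{t ∈ ℤ, t² < 4n} (ρ^{k-1} - ρ̄^{k-1})/(ρ - ρ̄) Σ_f h_w((t² - 4n)/f²) μ(t, f, n)`, where
  `ρ, ρ̄` are the zeroes of `X² - tX + n`, `f` runs over the positive divisors of `t² - 4n` with
  `(t² - 4n)/f² ∈ ℤ` congruent to `0` or `1 (mod 4)`, `h_w(-3) = 1/3`, `h_w(-4) = 1/2`,
  `h_w(Δ) = h(Δ)` (number of `SL₂(ℤ)`-classes of primitive positive definite binary quadratic forms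
  of discriminant `Δ`) for `Δ < -4`, and
  `μ(t, f, n) = ψ(N)/ψ(N/N_f) · Σ_{x (mod N), x² - tx + n ≡ 0 (mod N_f N)} χ(x)`, `N_f = gcd(N, f)`
  ("It is left to the reader to verify that the `x`'s occurring in the sum are well defined");
* `A₃ = -Σ'_{d ∣ n, 0 < d ≤ √n} d^{k-1} Σ_{c ∣ N, gcd(c, N/c) ∣ gcd(N/N_χ, n/d - d)} φ(gcd(c, N/c)) χ(y)`,
  where the prime means that the term `d = √n`, if present, is multiplied by `½`, `φ` is Euler's
  function, and `y` is defined modulo `N/gcd(c, N/c)` by `y ≡ d (mod c)`, `y ≡ n/d (mod N/c)`;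
* `A₄ = Σ_{t ∣ n, 0 < t, gcd(N, n/t) = 1} t` if `k = 2` and `χ = 1`, and `A₄ = 0` otherwise.

In the language of the GL₂ trace formula with `T_n` inserted at level `N`, nebentypus `χ` and the
weight-`k` discrete-series test function at infinity (request `defn-HeckeTraceFormulaGL2Level`): `A₁` is
the **identity term** (`δ_{n = □}`-type), `A₂` the **elliptic term** (orbital factor at trace `t`,
determinant `n`, times class numbers of the orders of discriminant `(t² - 4n)/f²` with the
level/character local densities `μ`), `A₃` the **hyperbolic (split) term** (`t² - 4n` a non-zero
square: divisor pairs `(d, n/d)`, for `n = p` the pair `(1, p)`), `A₄` the **parabolic / Eisenstein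
correction**.

## Lean rendering (this file)

* `heckeTn N k n`: `T_n` on `S_k(Γ₁(N)) = CuspForm (Gamma1 N) k` as in Diamond–Shurman §5.3
  (`T_1 = 1`, `T_{p^r} = T_p T_{p^{r-1}} - p^{k-1} ⟨p⟩ T_{p^{r-2}}`, `⟨p⟩ = 0` for `p ∣ N`,
  `T_n = ∏ T_{p^e}`), from the tree's `heckeT (Gamma1 N) k p = [Γ₁(N) diag(1,p) Γ₁(N)]` and
  `diamondOp N k` (`EllipticCurves/HeckeOperators.lean`); on `q`-expansions of `S_k(N, χ)` it acts by
  formula (2) of the source (Diamond–Shurman Prop. 5.3.1); `heckeTn_prime` (proved): `T_p = heckeT`.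
* `traceOn T W` (trace on a `T`-stable submodule, junk `0` otherwise), `cuspidalHeckeTrace N k χ n =
  Tr(T_n | S_k(N, χ))` with `S_k(N, χ) = nebentypusSubspace N k χ` (`EllipticCurves/Newforms.lean`;
  `T_n`-stable by Diamond–Shurman Prop. 5.2.4, the tree's fact `heckeT_diamondOp_comm`).
* `dedekindPsi`, `weightedClassNumber` (`h_w`, over the tree's `BinQF.classNumber = h(Δ)`,
  `QuadraticFields/BinaryQuadraticFormsClassNumber.lean`), `archFactor` and `tracePoly` (`Q_j(t, n)`
  of Remark 2.4; `archFactor_eq_tracePoly` proved), `localDensity` (`μ`), `crtCharValue` (`χ(y)` in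
  `A₃`), `identityTerm`, `ellipticTerm`, `hyperbolicTerm`, `parabolicTerm`, `geometricSide`.
* the NAMED FACT `HeckeTraceFormulaGL2Level N χ k : Prop` — Thm. 2.2 as printed, all `n ≥ 1`.

Rendering choices (definitionally harmless): (i) the weight is `k : ℤ` (Mathlib), `2 ≤ k` is a
hypothesis of the statement, and `n^{k/2-1}` is written `(√n)^{k-2}` (square `n` only); (ii) in `μ`
the `x (mod N)` run over `0 ≤ x < N` (the congruence mod `N_f N` does not depend on the
representative: `N_f ∣ 2x - t` for a solution); (iii) in `A₃`, `y` is the least natural solution of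
the two congruences (it exists exactly under the printed divisibility condition; `χ(y)` is independent
of the choice since `N_χ ∣ N/gcd(c, N/c)` and every prime factor of `N` divides `N/gcd(c, N/c)`);
(iv) `ρ, ρ̄ = (t ± i√(4n - t²))/2`.

Not vendored (no held source states it in closed form): the weight-`0` Maass / test-function
version `Σ_j h(t_j) λ_j(n) + (cont.) = …` for `Γ₀(N)` with nebentypus (Hejhal LNM 1001 ch. 11 — only
vol. 1 is held; Conrey–Li 2001 / Li 2005, arXiv:math/9907197, math/0107084: trivial character,
residue form; Booker–Lee–Strömbergsson arXiv:1803.06016 Thm. 8: `T_{±1}` only). Only the archimedean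
factor of `A₂` depends on the weight; `localDensity`, `weightedClassNumber`, `dedekindPsi` are shared.

Transcription checks (by hand, unit NOTES): `N = 1` gives the level-one formula (`μ ≡ 1`,
`Σ_f h_w = H(4n - t²)`, Prop. 2.1); `n = 1` gives the Cohen–Oesterlé dimension formula (Cor. 2.3);
`N = 2, k = 8, n = 5` gives `-208 - 2 = -210 = a₅(η(z)⁸η(2z)⁸)`.

## References

* [SchoofVandervlugt1991] R. Schoof, M. van der Vlugt, JCTA 57 (1991) 163–186, §2: Prop. 2.1,
  Thm. 2.2, Cor. 2.3, Remark 2.4, Thm. 2.5 (PDF pp. 3–8 of the held copy).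
* [Cohen1977TraceHecke] H. Cohen, Sém. Th. Nombres Bordeaux 1976–77, exp. 4; [Oesterle1977These]
  J. Oesterlé, thèse, Orsay 1977; [Hijikata1974] J. Math. Soc. Japan 26 (1974); [KnightlyLi2006]
  A. Knightly, C. Li, *Traces of Hecke operators*, AMS 2006; [DiamondShurman2005] §5.2–5.3.

Mathlib has `CuspForm`, congruence subgroups, Dirichlet characters/conductors, `LinearMap.trace`, but
no `T_n`, no trace formula, no form class numbers (`lean search 'HeckeSpectralTrace|TraceFormulaGL2|
ellipticTerm|hurwitz'`: no hits); the tree's `heckeT`, `diamondOp`, `nebentypusSubspace`,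
`BinQF.classNumber` are reused.
-/

noncomputable section

open scoped MatrixGroups ModularForm
open CongruenceSubgroup

namespace Literature.NumberTheory.Automorphic

open Literature.NumberTheory.EllipticCurves.ModularForms
open Literature.NumberTheory.QuadraticFields.Quadratic

namespace HeckeTraceFormulaGL2Level

/-! ## 1. Spectral side: `T_n` on `S_k(Γ₁(N))` and its trace on `S_k(N, χ)` -/

section Spectral

/-- The diamond operator `⟨d⟩` on `S_k(Γ₁(N))` for a natural number `d`, with the convention of
Diamond–Shurman §5.2–5.3 that `⟨d⟩ = 0` when `gcd(d, N) > 1` (the tree's `diamondOp` returns a junk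
value there). [cite: DiamondShurman2005, §5.3 (definition of T_n, convention ⟨n⟩ = 0 for gcd(n,N) > 1)] -/
def diamondOrZero (N : ℕ) [NeZero N] (k : ℤ) (d : ℕ) : Module.End ℂ (CuspForm (Gamma1 N) k) :=
  if Nat.Coprime d N then diamondOp N k (d : ZMod N) else 0

/-- The Hecke operator `T_{p^r}` on `S_k(Γ₁(N))`, defined as in Diamond–Shurman §5.3 by
`T_1 = 1`, `T_p = [Γ₁(N) diag(1, p) Γ₁(N)]` (the tree's `heckeT`) and
`T_{p^r} = T_p T_{p^{r-1}} - p^{k-1} ⟨p⟩ T_{p^{r-2}}` for `r ≥ 2`.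
[cite: DiamondShurman2005, §5.3 (definition of T_{p^r})] -/
def heckeTPrimePow (N : ℕ) [NeZero N] (k : ℤ) (p : ℕ) [NeZero p] :
    ℕ → Module.End ℂ (CuspForm (Gamma1 N) k)
  | 0 => 1
  | 1 => heckeT (Gamma1 N) k p
  | r + 2 => heckeT (Gamma1 N) k p * heckeTPrimePow N k p (r + 1) -
      (p : ℂ) ^ (k - 1) • (diamondOrZero N k p * heckeTPrimePow N k p r)

/-- The Hecke operator `T_n` on `S_k(Γ₁(N))` for `n ≥ 1`: `T_n = ∏_{p^e ‖ n} T_{p^e}` (product over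
the prime factorisation of `n`, in increasing order of `p`; the factors commute by Diamond–Shurman
Prop. 5.2.4, so the order is immaterial), `T_1 = 1` (and the junk value `T_0 = 1`). On
`S_k(N, χ)` its `q`-expansion action is `a_m(T_n f) = Σ_{d ∣ (m, n)} χ(d) d^{k-1} a_{mn/d²}(f)`
(Diamond–Shurman Prop. 5.3.1), i.e. formula (2) of [SchoofVandervlugt1991].
[cite: DiamondShurman2005, §5.3 (definition of T_n) and Prop. 5.3.1] -/
def heckeTn (N : ℕ) [NeZero N] (k : ℤ) (n : ℕ) : Module.End ℂ (CuspForm (Gamma1 N) k) :=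
  ((n.primeFactors.sort (· ≤ ·)).map fun p : ℕ =>
    if h : p = 0 then (1 : Module.End ℂ (CuspForm (Gamma1 N) k))
    else
      haveI : NeZero p := ⟨h⟩
      heckeTPrimePow N k p (n.factorization p)).prod

variable {V : Type*} [AddCommGroup V] [Module ℂ V]

open Classical in
/-- The trace of an endomorphism `T` of `V` on a submodule `W` that it stabilises: the trace of the
restriction `T|_W : W → W` (junk value `0` if `T` does not map `W` into itself; `LinearMap.trace`
is itself `0` on modules without a finite basis). [folklore] -/
def traceOn (T : Module.End ℂ V) (W : Submodule ℂ V) : ℂ :=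
  if h : ∀ w ∈ W, T w ∈ W then LinearMap.trace ℂ W (T.restrict h) else 0

/-- Unfolding `traceOn` on a `T`-stable submodule. [folklore] -/
theorem traceOn_eq_trace_restrict (T : Module.End ℂ V) (W : Submodule ℂ V)
    (h : ∀ w ∈ W, T w ∈ W) : traceOn T W = LinearMap.trace ℂ W (T.restrict h) := by
  unfold traceOn
  rw [dif_pos h]

/-- `Tr(T_n | S_k(Γ₀(N), χ))`: the trace of the Hecke operator `T_n` on the space
`S_k(N, χ) = {f ∈ S_k(Γ₁(N)) : ⟨d⟩ f = χ(d) f}` of cusp forms of level `N`, weight `k` and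
nebentypus `χ` (the tree's `nebentypusSubspace N k χ`; `T_n` stabilises it because it commutes
with the diamond operators, Diamond–Shurman Prop. 5.2.4, the tree's fact `heckeT_diamondOp_comm`).
This is the left-hand side `Tr(T_n)` of [SchoofVandervlugt1991, Thm. 2.2].
[cite: SchoofVandervlugt1991, §2, (2) and Thm. 2.2, pp. 167–168] -/
def cuspidalHeckeTrace (N : ℕ) [NeZero N] (k : ℤ) (χ : DirichletCharacter ℂ N) (n : ℕ) : ℂ :=
  traceOn (heckeTn N k n) (nebentypusSubspace N k χ)

variable (N : ℕ) [NeZero N] (k : ℤ)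

/-- `T_1 = 1` (Diamond–Shurman §5.3). [cite: DiamondShurman2005, §5.3] -/
@[simp] theorem heckeTn_one : heckeTn N k 1 = 1 := by
  simp [heckeTn]

/-- `T_{p^1} = T_p`. [folklore] -/
@[simp] theorem heckeTPrimePow_one (p : ℕ) [NeZero p] :
    heckeTPrimePow N k p 1 = heckeT (Gamma1 N) k p := rfl

/-- For a prime `p`, `T_p` in the sense of `heckeTn` is the double coset operator
`[Γ₁(N) diag(1, p) Γ₁(N)]` of the tree (`heckeT`). [cite: DiamondShurman2005, §5.3] -/
theorem heckeTn_prime (p : ℕ) [NeZero p] (hp : p.Prime) :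
    heckeTn N k p = heckeT (Gamma1 N) k p := by
  have h0 : p ≠ 0 := hp.ne_zero
  simp [heckeTn, hp.primeFactors, Finset.sort_singleton, h0, hp.factorization_self]

end Spectral

/-! ## 2. Geometric side: the terms `A₁, A₂, A₃, A₄` of Schoof–van der Vlugt, Thm. 2.2 -/

section Geometric

/-- The Dedekind `ψ`-function `ψ(N) = N ∏_{p ∣ N} (1 + 1/p)` (`= [SL₂(ℤ) : Γ₀(N)]`), as printed.
[cite: SchoofVandervlugt1991, Thm. 2.2 (definition of ψ(N)), p. 168] -/
def dedekindPsi (N : ℕ) : ℚ :=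
  N * ∏ p ∈ N.primeFactors, (1 + (p : ℚ)⁻¹)

/-- The weighted class number `h_w(Δ)`: `h_w(-3) = 1/3`, `h_w(-4) = 1/2` and `h_w(Δ) = h(Δ)` (the
number of `SL₂(ℤ)`-classes of primitive positive definite integral binary quadratic forms of
discriminant `Δ`, the tree's `BinQF.classNumber`, counted via reduced forms) for `Δ < -4`; so that
the Kronecker class number is `H(Δ) = Σ_f h_w(Δ/f²)` (loc. cit. Prop. 2.1).
[cite: SchoofVandervlugt1991, Prop. 2.1, p. 165] -/
def weightedClassNumber (Δ : ℤ) : ℚ :=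
  if Δ = -3 then 1 / 3 else if Δ = -4 then 1 / 2 else (BinQF.classNumber Δ : ℚ)

/-- The archimedean (weight-`k`) factor `(ρ^{k-1} - ρ̄^{k-1})/(ρ - ρ̄)` of the elliptic term, where
`ρ, ρ̄ = (t ± i√(4n - t²))/2` are the zeroes of `X² - tX + n` (used for `t² < 4n`); it equals the
polynomial `Q_{k-2}(t, n)` of loc. cit. Remark 2.4 (`Q₀ = 1`, `Q₁ = t`, `Q_{j+1} = t Q_j - n Q_{j-1}`).
[cite: SchoofVandervlugt1991, Thm. 2.2 (term A₂) and Remark 2.4, pp. 168–169] -/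
def archFactor (k : ℤ) (t : ℤ) (n : ℕ) : ℂ :=
  ((((t : ℂ) + Complex.I * (Real.sqrt (4 * n - (t : ℝ) ^ 2) : ℂ)) / 2) ^ (k - 1) -
      (((t : ℂ) - Complex.I * (Real.sqrt (4 * n - (t : ℝ) ^ 2) : ℂ)) / 2) ^ (k - 1)) /
    (Complex.I * (Real.sqrt (4 * n - (t : ℝ) ^ 2) : ℂ))

/-- The polynomials `Q_j(t, n)` of loc. cit. Remark 2.4: `Q₀ = 1`, `Q₁ = t`,
`Q_{j+1} = t Q_j - n Q_{j-1}`, so that `(ρ^{k-1} - ρ̄^{k-1})/(ρ - ρ̄) = Q_{k-2}(t, n)`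
(`archFactor_eq_tracePoly`); e.g. `Q₂ = t² - n`, `Q₃ = t³ - 2nt`.
[cite: SchoofVandervlugt1991, Remark 2.4, p. 169] -/
def tracePoly (t n : ℤ) : ℕ → ℤ
  | 0 => 1
  | 1 => t
  | j + 2 => t * tracePoly t n (j + 1) - n * tracePoly t n j

variable (N : ℕ) (χ : DirichletCharacter ℂ N) (k : ℤ)

/-- The local density `μ(t, f, n) = ψ(N)/ψ(N/N_f) · Σ_{x (mod N), x² - tx + n ≡ 0 (mod N_f N)} χ(x)`,
`N_f = gcd(N, f)`, of the elliptic term (the sum taken over the representatives `0 ≤ x < N`; the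
congruence modulo `N_f N` does not depend on the representative).
[cite: SchoofVandervlugt1991, Thm. 2.2 (definition of μ(t, f, n)), p. 168] -/
def localDensity (t : ℤ) (f n : ℕ) : ℂ :=
  ((dedekindPsi N / dedekindPsi (N / Nat.gcd N f) : ℚ) : ℂ) *
    ∑ x ∈ Finset.range N,
      if ((N * Nat.gcd N f : ℕ) : ℤ) ∣ (x : ℤ) ^ 2 - t * x + n then χ (x : ZMod N) else 0

/-- **Identity term** `A₁ = n^{k/2-1} χ(√n) (k-1)/12 · ψ(N)` (zero unless `n` is a square).
[cite: SchoofVandervlugt1991, Thm. 2.2 (A₁), p. 168] -/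
def identityTerm (n : ℕ) : ℂ :=
  if IsSquare n then
    (Nat.sqrt n : ℂ) ^ (k - 2) * χ (Nat.sqrt n : ZMod N) * (((k : ℂ) - 1) / 12) * (dedekindPsi N : ℂ)
  else 0

/-- The set of conductors `f` in the elliptic term for the discriminant `t² - 4n < 0`: positive
`f` with `f² ∣ t² - 4n` and `(t² - 4n)/f² ≡ 0, 1 (mod 4)`.
[cite: SchoofVandervlugt1991, Thm. 2.2 (A₂), p. 168] -/
def ellipticConductors (t : ℤ) (n : ℕ) : Finset ℕ :=
  ((4 * n - t ^ 2).toNat.divisors).filter fun f =>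
    (f : ℤ) ^ 2 ∣ t ^ 2 - 4 * n ∧
      (((t ^ 2 - 4 * n) / (f : ℤ) ^ 2) % 4 = 0 ∨ ((t ^ 2 - 4 * n) / (f : ℤ) ^ 2) % 4 = 1)

/-- **Elliptic term**
`A₂ = -½ Σ_{t ∈ ℤ, t² < 4n} (ρ^{k-1} - ρ̄^{k-1})/(ρ - ρ̄) Σ_f h_w((t² - 4n)/f²) μ(t, f, n)`.
[cite: SchoofVandervlugt1991, Thm. 2.2 (A₂), p. 168] -/
def ellipticTerm (n : ℕ) : ℂ :=
  -(1 / 2 : ℂ) *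
    ∑ t ∈ (Finset.Icc (-(2 * n : ℤ)) (2 * n)).filter (fun t : ℤ => t ^ 2 < 4 * (n : ℤ)),
      archFactor k t n *
        ∑ f ∈ ellipticConductors t n,
          (weightedClassNumber ((t ^ 2 - 4 * n) / (f : ℤ) ^ 2) : ℂ) * localDensity N χ t f n

open Classical in
/-- `χ(y)` for "the number `y` defined modulo `N/gcd(c, N/c)` by `y ≡ a (mod c)`, `y ≡ b (mod e)`"
(`e = N/c`): the value of `χ` at the least natural number solving the two congruences (`0` if there
is none; under the divisibility condition of `A₃` a solution exists and `χ(y)` does not depend on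
the choice of solution). [cite: SchoofVandervlugt1991, Thm. 2.2 (A₃), p. 168] -/
def crtCharValue (c e a b : ℕ) : ℂ :=
  if h : ∃ y : ℕ, (c : ℤ) ∣ (y : ℤ) - a ∧ (e : ℤ) ∣ (y : ℤ) - b then χ (Nat.find h : ZMod N)
  else 0

/-- **Hyperbolic (split) term**
`A₃ = -Σ'_{d ∣ n, 0 < d ≤ √n} d^{k-1} Σ_{c ∣ N, gcd(c, N/c) ∣ gcd(N/N_χ, n/d - d)} φ(gcd(c, N/c)) χ(y)`,
the term `d = √n` (if present) weighted by `½`, `y ≡ d (mod c)`, `y ≡ n/d (mod N/c)`, `N_χ` the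
conductor of `χ`. [cite: SchoofVandervlugt1991, Thm. 2.2 (A₃), p. 168] -/
def hyperbolicTerm (n : ℕ) : ℂ :=
  -∑ d ∈ n.divisors.filter (fun d => d * d ≤ n),
    (if d * d = n then (1 / 2 : ℂ) else 1) * (d : ℂ) ^ (k - 1) *
      ∑ c ∈ N.divisors.filter (fun c =>
          Nat.gcd c (N / c) ∣ N / χ.conductor ∧ (Nat.gcd c (N / c) : ℤ) ∣ ((n / d : ℕ) : ℤ) - d),
        (Nat.totient (Nat.gcd c (N / c)) : ℂ) * crtCharValue N χ c (N / c) d (n / d)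

/-- **Parabolic / Eisenstein term** `A₄ = Σ_{t ∣ n, gcd(N, n/t) = 1} t` if `k = 2` and `χ` is the
trivial character, `A₄ = 0` otherwise. [cite: SchoofVandervlugt1991, Thm. 2.2 (A₄), p. 168] -/
def parabolicTerm (n : ℕ) : ℂ :=
  open Classical in
  if k = 2 ∧ χ = 1 then ∑ t ∈ n.divisors.filter (fun t => Nat.Coprime N (n / t)), (t : ℂ) else 0

/-- The **geometric side** `A₁ + A₂ + A₃ + A₄` of the Eichler–Selberg trace formula for `T_n` on
`S_k(Γ₀(N), χ)`. [cite: SchoofVandervlugt1991, Thm. 2.2, p. 168] -/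
def geometricSide (n : ℕ) : ℂ :=
  identityTerm N χ k n + ellipticTerm N χ k n + hyperbolicTerm N χ k n + parabolicTerm N χ k n

/-! ### Unfolding / vanishing lemmas -/

/-- `A₁ = 0` unless `n` is a square. [cite: SchoofVandervlugt1991, Thm. 2.2 (A₁), p. 168] -/
theorem identityTerm_of_not_isSquare {n : ℕ} (hn : ¬ IsSquare n) : identityTerm N χ k n = 0 := by
  simp [identityTerm, hn]

/-- `A₄ = 0` in weight `k ≠ 2`. [cite: SchoofVandervlugt1991, Thm. 2.2 (A₄), p. 168] -/
theorem parabolicTerm_of_ne_two {k : ℤ} (hk : k ≠ 2) (n : ℕ) : parabolicTerm N χ k n = 0 := by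
  simp [parabolicTerm, hk]

/-- `A₄ = 0` for a non-trivial character. [cite: SchoofVandervlugt1991, Thm. 2.2 (A₄), p. 168] -/
theorem parabolicTerm_of_ne_one (hχ : χ ≠ 1) (n : ℕ) : parabolicTerm N χ k n = 0 := by
  simp [parabolicTerm, hχ]

/-- `ψ(1) = 1`. [folklore] -/
@[simp] theorem dedekindPsi_one : dedekindPsi 1 = 1 := by
  simp [dedekindPsi]

/-- `ψ(p) = p + 1` for `p` prime. [folklore] -/
theorem dedekindPsi_prime {p : ℕ} (hp : p.Prime) : dedekindPsi p = p + 1 := by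
  have hp0 : (p : ℚ) ≠ 0 := by exact_mod_cast hp.ne_zero
  simp [dedekindPsi, hp.primeFactors]
  field_simp

/-- `h_w(-3) = 1/3`. [cite: SchoofVandervlugt1991, Prop. 2.1, p. 165] -/
@[simp] theorem weightedClassNumber_neg_three : weightedClassNumber (-3) = 1 / 3 := by
  simp [weightedClassNumber]

/-- `h_w(-4) = 1/2`. [cite: SchoofVandervlugt1991, Prop. 2.1, p. 165] -/
@[simp] theorem weightedClassNumber_neg_four : weightedClassNumber (-4) = 1 / 2 := by
  simp [weightedClassNumber]

/-- `h_w(Δ) = h(Δ)` for `Δ ∉ {-3, -4}`. [cite: SchoofVandervlugt1991, Prop. 2.1, p. 165] -/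
theorem weightedClassNumber_of_ne {Δ : ℤ} (h3 : Δ ≠ -3) (h4 : Δ ≠ -4) :
    weightedClassNumber Δ = BinQF.classNumber Δ := by
  simp [weightedClassNumber, h3, h4]

/-- In weight `2` the archimedean factor is `(ρ - ρ̄)/(ρ - ρ̄) = 1` (for `t² < 4n`).
[cite: SchoofVandervlugt1991, Remark 2.4 (Q₀ = 1), p. 169] -/
theorem archFactor_two {t : ℤ} {n : ℕ} (h : t ^ 2 < 4 * n) : archFactor 2 t n = 1 := by
  have hpos : (0 : ℝ) < 4 * n - (t : ℝ) ^ 2 := by exact_mod_cast (show (0 : ℤ) < 4 * n - t ^ 2 by omega)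
  have hs : (Real.sqrt (4 * n - (t : ℝ) ^ 2) : ℂ) ≠ 0 := by
    exact_mod_cast (Real.sqrt_pos.mpr hpos).ne'
  have hI : Complex.I * (Real.sqrt (4 * n - (t : ℝ) ^ 2) : ℂ) ≠ 0 := mul_ne_zero Complex.I_ne_zero hs
  unfold archFactor
  rw [show (2 : ℤ) - 1 = 1 by norm_num, zpow_one, zpow_one, div_eq_one_iff_eq hI]
  ring

/-- **Remark 2.4 of the source:** for `t² < 4n` and weight `k = j + 2 ≥ 2`,
`(ρ^{k-1} - ρ̄^{k-1})/(ρ - ρ̄) = Q_{k-2}(t, n)` (two-step induction from `ρ + ρ̄ = t`, `ρρ̄ = n`).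
[cite: SchoofVandervlugt1991, Remark 2.4, p. 169] -/
theorem archFactor_eq_tracePoly {t : ℤ} {n : ℕ} (h : t ^ 2 < 4 * (n : ℤ)) (j : ℕ) :
    archFactor (j + 2) t n = tracePoly t n j := by
  have hle : (0 : ℝ) ≤ 4 * n - (t : ℝ) ^ 2 := by
    exact_mod_cast (show (0 : ℤ) ≤ 4 * n - t ^ 2 by omega)
  have hpos : (0 : ℝ) < 4 * n - (t : ℝ) ^ 2 := by
    exact_mod_cast (show (0 : ℤ) < 4 * n - t ^ 2 by omega)
  unfold archFactor
  rw [show (j : ℤ) + 2 - 1 = ((j + 1 : ℕ) : ℤ) by push_cast; ring, zpow_natCast, zpow_natCast]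
  set s : ℂ := Complex.I * (Real.sqrt (4 * n - (t : ℝ) ^ 2) : ℂ) with hs_def
  set ρ : ℂ := ((t : ℂ) + s) / 2 with hρ
  set ρ' : ℂ := ((t : ℂ) - s) / 2 with hρ'
  have hs0 : s ≠ 0 :=
    mul_ne_zero Complex.I_ne_zero (by exact_mod_cast (Real.sqrt_pos.mpr hpos).ne')
  have hs2 : s ^ 2 = -(4 * n - (t : ℂ) ^ 2) := by
    rw [hs_def, mul_pow, Complex.I_sq, ← Complex.ofReal_pow, Real.sq_sqrt hle]
    push_cast
    ring
  have hsum : ρ + ρ' = t := by rw [hρ, hρ']; ring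
  have hprod : ρ * ρ' = n := by
    have : ρ * ρ' = ((t : ℂ) ^ 2 - s ^ 2) / 4 := by rw [hρ, hρ']; ring
    rw [this, hs2]
    ring
  have hdiff : ρ - ρ' = s := by rw [hρ, hρ']; ring
  have key : ∀ i : ℕ, ρ ^ (i + 1) - ρ' ^ (i + 1) = (tracePoly t n i : ℂ) * (ρ - ρ') ∧
      ρ ^ (i + 2) - ρ' ^ (i + 2) = (tracePoly t n (i + 1) : ℂ) * (ρ - ρ') := by
    intro i
    induction i with
    | zero =>
      refine ⟨by simp [tracePoly], ?_⟩
      have e : ρ ^ 2 - ρ' ^ 2 = (ρ + ρ') * (ρ - ρ') := by ring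
      rw [e, hsum]
      simp [tracePoly]
    | succ i ih =>
      obtain ⟨h1, h2⟩ := ih
      refine ⟨h2, ?_⟩
      have e : ρ ^ (i + 1 + 2) - ρ' ^ (i + 1 + 2) =
          (ρ + ρ') * (ρ ^ (i + 2) - ρ' ^ (i + 2)) - ρ * ρ' * (ρ ^ (i + 1) - ρ' ^ (i + 1)) := by ring
      rw [e, h2, h1, hsum, hprod]
      simp only [tracePoly]
      push_cast
      ring
  rw [(key j).1, hdiff, mul_div_assoc, div_self hs0, mul_one]

end Geometric

end HeckeTraceFormulaGL2Level

/-! ## 3. The named fact -/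

open HeckeTraceFormulaGL2Level in
/-- **The Eichler–Selberg trace formula on `Γ₀(N)` with nebentypus** (Cohen–Oesterlé form), as
printed in [SchoofVandervlugt1991, Thm. 2.2]: let `χ` be a Dirichlet character modulo `N` and `k ≥ 2`
an integer with `χ(-1) = (-1)^k`; then for every `n ≥ 1`,
`Tr(T_n | S_k(Γ₀(N), χ)) = A₁ + A₂ + A₃ + A₄` with the four terms `identityTerm`, `ellipticTerm`,
`hyperbolicTerm`, `parabolicTerm` of this file (`geometricSide`). This is the holomorphic
(weight `k ≥ 2` discrete series at infinity) case of the GL₂ trace formula with the Hecke operator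
`T_n` at level `N` and central character `χ`; formula due to Eichler, Selberg, Hijikata (1974),
Cohen and Oesterlé (1977). [cite: SchoofVandervlugt1991, Thm. 2.2, p. 168] -/
def HeckeTraceFormulaGL2Level (N : ℕ) [NeZero N] (χ : DirichletCharacter ℂ N) (k : ℤ) : Prop :=
  2 ≤ k → χ (-1) = (-1 : ℂ) ^ k →
    ∀ n : ℕ, 0 < n → cuspidalHeckeTrace N k χ n = geometricSide N χ k n

end Literature.NumberTheory.Automorphic
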